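import Literature.MathematicalPhysics.StatisticalMechanics.Theil2006ReferenceConsequences
import Literature.MathematicalPhysics.StatisticalMechanics.Theil2006ReferenceUniqueness
import Literature.MathematicalPhysics.StatisticalMechanics.Theil2006ReferenceSurjectivity
import HarnessLib

/-!
# Theil 2006, Appendix pp. 23–25 — the local geometry of §2.3 from Proposition 4.8 applied to
concentric balls (the radii bookkeeping), proofs

Topic `Literature/MathematicalPhysics/StatisticalMechanics`; companion of `Theil2006.lean`
(F. Theil, *A proof of crystallization in two dimensions*, Comm. Math. Phys. **262** (2006)
209–236, accepted preprint of 26 Aug 2005, lit store `paper:url-69bff4ce1e30`), Appendix,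
Proposition 4.8 (p. 21) and the printed proofs of Lemma 2.7, Proposition 2.8 and (70) (pp. 23–24).
PROVED; the conclusion of Proposition 4.8 — for the one configuration `y` at hand and for ALL
pairs of concentric open balls `Ω′ = B(c,r) ⊂ Ω = B(c,R)`, `R ≥ 4r + 2`, free of defects — is the
explicit hypothesis `Theil2006.HasReferences α y K` (a predicate with a body; D-0026: no named
fact is introduced).

## Source, as printed (preprint p. 21)

"**Proposition 4.8.** (Existence of a reference configuration) There exist constants `α₀, K > 0`
such that for all `α ∈ (0, α₀)` and all domains `Ω′ ⊂ Ω ⊂ ℝ²` with the properties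
`dist(Ω′, ∂Ω) ≥ 3 diam(Ω′) + 2`, `Ω` is convex and `Ω ∩ y(∂X) = ∅` there exists a discrete
imbedding `Φ : ω → A₂` where `ω = y⁻¹(Ω′)`. Furthermore, the following assertions are true.
(1) `Φ` is unique up to rotation and translation, i.e. for each discrete imbedding `Φ′ : ω → A₂`,
there exists a rotation matrix `R ∈ SO(2)` such that (60) `Φ′(x) − Φ′(x′) = R(Φ(x) − Φ(x′))` for all
`x, x′ ∈ ω`. (2) `Φ` satisfies the rigidity estimate
(61) `sup_{{x,x′}⊂ω} | |Φ(x)−Φ(x′)| / |y(x)−y(x′)| − 1 | ≤ Kα`. (3) `Φ` is surjective in the sense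
that if `B(y(x), r) ⊂ Ω′` for some `x ∈ X` and `r > 0`, then (62) `Φ(ω) ⊃ B(Φ(x), ½ r) ∩ A₂`."

The paper applies it only to concentric balls (p. 23: `Ω = B(z,20λ)`, `Ω′ = B(z,3λ)`;
`Ω = B(η,14λ₁)`, `Ω′ = B(η,2λ₁)`; p. 24: `Ω = B(z,28|y(x₁)−y(x₂)|)`, `Ω′ = B(z,5|y(x₁)−y(x₂)|)`;
`Ω = B(y(x),28λ)`, `Ω′ = B(y(x),4λ)`), and in all four applications the hypothesis
`dist(Ω′,∂Ω) ≥ 3 diam(Ω′) + 2` holds only if "diam" is read as the RADIUS of the ball `Ω′`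
(`R − r ≥ 3r + 2`, i.e. `R ≥ 4r + 2`); with the diameter all four fail (LIT1-AS-PRINTED §32, print
flag F1). `HasReferences` is Proposition 4.8's conclusion in exactly this ball form, for radii
`r ≥ 2` (a lower bound the print omits but needs: for a tiny `Ω′` capturing a particle and two
opposite neighbours only, (60) fails — print flag F4; the printed applications have
`r ≥ 2λ₁ ≥ 2√3`, ours below `r ≥ 2`), with (60) for an arbitrary linear isometry `R` (weaker
than the printed `R ∈ SO(2)`, so the printed statement implies it: `HasReferences.of_so2`).

## What is proved (all for CENTRED simplices, `Theil2006.IsCentredSimplex`, flag F3)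

From `HasReferences α y K`, (13) and `0 < α ≤ 1/200`, `Kα ≤ 1/10`, choosing the radii as on
pp. 23–24 (LIT1 §32 addendum 2) and feeding the one-ball lemmas of
`Theil2006ReferenceConsequences.lean`:

* `Theil2006.HasReferences.lemma27` — **Lemma 2.7 (25)** for every `T ∈ 𝒯_λ(y)`, `λ ∈ Λ`, with
  constant `2K + 1` [`Ω′ = B(z, λ+1)`, `Ω = B(z, 4λ+6) ⊂ B(z, 20λ)`];
* `Theil2006.HasReferences.sideParameter_unique` — **Proposition 2.8 (1)**, uniqueness of the side
  parameter of a long simplex [`Ω′ = B(z, min(λ,λ′)+1)`];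
* `Theil2006.HasReferences.card_longSimplices_through_le_two` — **Proposition 2.8 (1)**,
  `#𝒯(x₁,x₂) ≤ 2` for long pairs [`Ω′ = B(m, max(d/2+1, 2))` to read off the common side `λ₀`
  (`side_eq_dist_reference_of_radius`), then `Ω′ = B(m, 3λ₀/2+1)` and "(68) has at most two
  solutions"];
* `Theil2006.HasReferences.exists_defect_near_pair` — **Proposition 2.8 (3)**: `#𝒯(x₁,x₂) ≤ 1` only
  if a defect lies within `28|y(x₁)−y(x₂)|` of the midpoint [contrapositive of (2):
  `Ω′ = B(y(x₁), 5d)`, `Ω = B(y(x₁), 20d+2) ⊂ B(y(x₁), 27.5d)`, (62) with `ρ = 4d`];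
* `Theil2006.HasReferences.h70` — **(70)** `s(x,λ) ≤ m(λ) s(x,1)` [`Ω′ = B(y(x), ρ′)` with
  `y⁻¹(B̄(y(x),2λ)) = y⁻¹(B(y(x),ρ′))`, `ρ′ ≤ 2λ+1`, `Ω = B(y(x), 4ρ′+2) ⊂ B(y(x), 19λ)`];
* `Theil2006.HasReferences.exists_defect_near_corner` — the **near-defect alternative**
  "`s(x,λ) < 6m(λ)` ⇒ `y(∂X) ∩ B̄(y(x), 28λ) ≠ ∅`" (p. 24) [`Ω′ = B(y(x), 5λ)`, `Ω = B(y(x), 20λ+2)`,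
  (62) with `ρ = 3λ`];
* `Theil2006.HasReferences.of_exists_rigid` — (60) AND (62) need not be assumed: (62) holds
  for every discrete imbedding of a defect-free ball patch
  (`Theil2006.IsDiscreteImbeddingOn.exists_eq_of_ball_subset`,
  `Theil2006ReferenceSurjectivity.lean`), so existence with (61) suffices;
* `Theil2006.HasReferences.of_exists` — (60) need not be assumed: by
  `Theil2006.discreteImbedding_unique_ball` (Proposition 4.8 (1) proved for ball patches,
  `Theil2006ReferenceUniqueness.lean`) discrete imbeddings with (61), (62) on the balls suffice;
* `Theil2006.HasReferences.card_filter_mem_patch_le` — **(28)** `#{T ∈ 𝒯_λ(y) | ω_T ∋ x} ≤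
  4056 λ² m(λ)` for any patches with `y(ω_T) ⊂ B̄(z_T, 5λ)` ("from (70) and (71)", p. 25);
  `HasReferences.rigidityInputs` — with the printed per-simplex rigidity display of p. 11
  (Proposition 4.3 applied on `ω_T`) this gives the (34)-inputs;
* `Theil2006.HasReferences.localGeometry` — the six statements bundled in the shape of the
  hypothesis `hlocal` of `Theil2006_mainTheorems_of_localGeometry` (`Theil2006FromGeometry.lean`).

So, modulo Proposition 4.8 in ball form, the only inputs of Theorem 1.1 / Theorem 1.2 (corrected) /
Corollary 1.3 not derived in the tree are the (27)-inputs (partition identity, (72)) and the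
per-simplex rigidity display of p. 11 ((52) of Proposition 4.3 transported to `ω_T`) — see
`Theil2006FromReferences.lean`.
-/

noncomputable section

namespace Literature.MathematicalPhysics.StatisticalMechanics

namespace Theil2006

open Metric

variable {α : ℝ} {N : ℕ} {y : Fin N → Plane}

/-! ### Proposition 4.8's conclusion on one pair of concentric balls, and on all of them -/

/-- **The conclusion of Proposition 4.8 on `Ω′ = B(c, r)`** for a discrete map `Φ` (lattice
coordinates) of the configuration `y : X_N → ℝ²`: `Φ` is a discrete imbedding of
`ω = y⁻¹(B(c,r))` (Definition 2.4); (60) every discrete imbedding `Φ′` of `ω` satisfies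
`Φ′(x) − Φ′(x′) = R(Φ(x) − Φ(x′))` on `ω` for some linear isometry `R` (the print has `R ∈ SO(2)`;
this weaker form is all that pp. 23–25 use); (61) `| |Φ(x)−Φ(x′)|/|y(x)−y(x′)| − 1 | ≤ Kα` for
`x ≠ x′ ∈ ω`; (62) if `B(y(x), ρ) ⊂ B(c, r)`, `ρ > 0`, then every lattice point within `ρ/2` of
`Φ(x)` is the image of a particle of `ω`.
[cite: Theil2006, Appendix Proposition 4.8 (60)–(62) (preprint p. 21)] -/
structure IsReferenceOn (α : ℝ) (y : Fin N → Plane) (K : ℝ) (c : Plane) (r : ℝ)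
    (Φ : Fin N → ℤ × ℤ) : Prop where
  /-- `Φ` is a discrete imbedding of `ω = y⁻¹(B(c, r))`. -/
  imbedding : IsDiscreteImbeddingOn α y (y ⁻¹' ball c r) Φ
  /-- (60): uniqueness up to a rigid motion, on differences. -/
  unique : ∀ Φ' : Fin N → ℤ × ℤ, IsDiscreteImbeddingOn α y (y ⁻¹' ball c r) Φ' →
    ∃ Rot : Plane ≃ₗᵢ[ℝ] Plane, ∀ x x' : Fin N, y x ∈ ball c r → y x' ∈ ball c r →
      triPoint (Φ' x) - triPoint (Φ' x') = Rot (triPoint (Φ x) - triPoint (Φ x'))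
  /-- (61): the rigidity estimate. -/
  rigidity : ∀ x x' : Fin N, y x ∈ ball c r → y x' ∈ ball c r → x ≠ x' →
    |dist (triPoint (Φ x)) (triPoint (Φ x')) / dist (y x) (y x') - 1| ≤ K * α
  /-- (62): surjectivity onto `B(Φ(x), ρ/2) ∩ A₂` whenever `B(y(x), ρ) ⊂ Ω′`. -/
  surjective : ∀ (x : Fin N) (ρ : ℝ), 0 < ρ → ball (y x) ρ ⊆ ball c r →
    ∀ g : ℤ × ℤ, dist (triPoint g) (triPoint (Φ x)) < ρ / 2 →
      ∃ x'' : Fin N, y x'' ∈ ball c r ∧ Φ x'' = g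

/-- **Proposition 4.8 in ball form, as a property of one configuration `y` (with `α` and the
constant `K` fixed):** for all concentric open balls `Ω′ = B(c,r) ⊂ Ω = B(c,R)` with `r ≥ 2`,
`R ≥ 4r + 2` (the printed `dist(Ω′,∂Ω) ≥ 3 diam(Ω′) + 2` with `diam(Ω′)` read as the radius, the
reading under which the paper's four applications satisfy it) and `Ω ∩ y(∂X) = ∅`, there is a
reference configuration on `Ω′` with (60), (61) (constant `K`), (62). The lower bound `r ≥ 2`
(absent from the print, satisfied by all four printed applications, whose radii are `≥ 2λ₁ ≥ 2√3`)
is NECESSARY for (60): for `Ω′ = B(y(x), 1)` capturing a non-defect `x` and two opposite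
neighbours only (the other four sitting at distance `∈ (1, 1+α]`), `ω = {x, p₀, p₃}` carries no
`𝒮`-triangle, so discrete imbeddings of `ω` may send `p₃ − x` to any unit vector and are not
related by a rotation (LIT1-AS-PRINTED §34, print flag F4).
[cite: Theil2006, Appendix Proposition 4.8 (preprint p. 21); applications pp. 23–24; threshold ours] -/
def HasReferences (α : ℝ) (y : Fin N → Plane) (K : ℝ) : Prop :=
  ∀ (c : Plane) (r R : ℝ), 2 ≤ r → 4 * r + 2 ≤ R → (∀ b ∈ defects α y, R ≤ dist (y b) c) →
    ∃ Φ : Fin N → ℤ × ℤ, IsReferenceOn α y K c r Φ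

/-- The printed form of Proposition 4.8's conclusion (ball form, radius `≥ 2`, (60) with
`R ∈ SO(2)`, i.e. a linear isometry of determinant `1`) implies `HasReferences`.
[cite: Theil2006, Appendix Proposition 4.8 (60) (preprint p. 21)] -/
theorem HasReferences.of_so2 {K : ℝ}
    (h : ∀ (c : Plane) (r R : ℝ), 2 ≤ r → 4 * r + 2 ≤ R → (∀ b ∈ defects α y, R ≤ dist (y b) c) →
      ∃ Φ : Fin N → ℤ × ℤ, IsDiscreteImbeddingOn α y (y ⁻¹' ball c r) Φ ∧
        (∀ Φ' : Fin N → ℤ × ℤ, IsDiscreteImbeddingOn α y (y ⁻¹' ball c r) Φ' →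
          ∃ Rot : Plane ≃ₗᵢ[ℝ] Plane,
            LinearMap.det (Rot.toLinearEquiv : Plane →ₗ[ℝ] Plane) = 1 ∧
            ∀ x x' : Fin N, y x ∈ ball c r → y x' ∈ ball c r →
              triPoint (Φ' x) - triPoint (Φ' x') = Rot (triPoint (Φ x) - triPoint (Φ x'))) ∧
        (∀ x x' : Fin N, y x ∈ ball c r → y x' ∈ ball c r → x ≠ x' →
          |dist (triPoint (Φ x)) (triPoint (Φ x')) / dist (y x) (y x') - 1| ≤ K * α) ∧
        (∀ (x : Fin N) (ρ : ℝ), 0 < ρ → ball (y x) ρ ⊆ ball c r →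
          ∀ g : ℤ × ℤ, dist (triPoint g) (triPoint (Φ x)) < ρ / 2 →
            ∃ x'' : Fin N, y x'' ∈ ball c r ∧ Φ x'' = g)) :
    HasReferences α y K := by
  intro c r R hr hR hdef
  obtain ⟨Φ, hΦ, h60, h61, h62⟩ := h c r R hr hR hdef
  refine ⟨Φ, hΦ, fun Φ' hΦ' => ?_, h61, h62⟩
  obtain ⟨Rot, -, hRot⟩ := h60 Φ' hΦ'
  exact ⟨Rot, hRot⟩

/-- (61) with constant `K` gives (61) with any larger constant. [folklore] -/
private theorem HasReferences.mono {K K' : ℝ} (hα : 0 ≤ α) (h : HasReferences α y K) (hK : K ≤ K') :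
    HasReferences α y K' := by
  intro c r R hr hR hdef
  obtain ⟨Φ, hΦ, h60, h61, h62⟩ := h c r R hr hR hdef
  exact ⟨Φ, hΦ, h60, fun x x' hx hx' hxx' =>
    (h61 x x' hx hx' hxx').trans (mul_le_mul_of_nonneg_right hK hα), h62⟩

/-! ### Bookkeeping: finset defects vs. the defect set, long side parameters -/

/-- The finset `defects α y` lists the defect set `∂X(y)`. [cite: Theil2006, §2.1 (preprint p. 4)] -/
theorem mem_defects_iff_mem_defectSet {b : Fin N} : b ∈ defects α y ↔ b ∈ defectSet α y := by
  rw [← Finset.mem_coe, coe_defects]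

/-- **(60) comes for free: existence with (61), (62) suffices.** By
`Theil2006.discreteImbedding_unique_ball` (`Theil2006ReferenceUniqueness.lean`: Proposition 4.8 (1)
proved for ball patches of radius `≥ 2` with the defects `≥ r + 2` away — here `R ≥ 4r + 2 ≥ r + 2`),
a family of discrete imbeddings of the patches `y⁻¹(B(c,r))` with the rigidity estimate (61) and
the surjectivity (62) already satisfies `HasReferences` (`0 < α ≤ 1/200`, (13)).
[cite: Theil2006, Appendix Proposition 4.8 (60)–(62) (preprint p. 21)] -/
theorem HasReferences.of_exists {K : ℝ} (hα : 0 < α) (hα' : α ≤ 1 / 200)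
    (hsep : ∀ i j : Fin N, i ≠ j → 1 - α < dist (y i) (y j))
    (h : ∀ (c : Plane) (r R : ℝ), 2 ≤ r → 4 * r + 2 ≤ R → (∀ b ∈ defects α y, R ≤ dist (y b) c) →
      ∃ Φ : Fin N → ℤ × ℤ, IsDiscreteImbeddingOn α y (y ⁻¹' ball c r) Φ ∧
        (∀ x x' : Fin N, y x ∈ ball c r → y x' ∈ ball c r → x ≠ x' →
          |dist (triPoint (Φ x)) (triPoint (Φ x')) / dist (y x) (y x') - 1| ≤ K * α) ∧
        (∀ (x : Fin N) (ρ : ℝ), 0 < ρ → ball (y x) ρ ⊆ ball c r →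
          ∀ g : ℤ × ℤ, dist (triPoint g) (triPoint (Φ x)) < ρ / 2 →
            ∃ x'' : Fin N, y x'' ∈ ball c r ∧ Φ x'' = g)) :
    HasReferences α y K := by
  intro c r R hr hR hdef
  obtain ⟨Φ, hΦ, h61, h62⟩ := h c r R hr hR hdef
  refine ⟨Φ, hΦ, fun Φ' hΦ' => ?_, h61, h62⟩
  have hdef' : ∀ b ∈ defectSet α y, r + 2 ≤ dist (y b) c := fun b hb => by
    have := hdef b (mem_defects_iff_mem_defectSet.2 hb); linarith
  exact discreteImbedding_unique_ball' hα hα' hsep hr hdef' hΦ hΦ'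

/-- **(60) and (62) come for free: existence with (61) suffices.** The surjectivity (62) holds
for every discrete imbedding of a defect-free ball patch
(`Theil2006.IsDiscreteImbeddingOn.exists_eq_of_ball_subset`, Proposition 4.8 (3) proved in
`Theil2006ReferenceSurjectivity.lean`), and (60) by `HasReferences.of_exists`; so a family of
discrete imbeddings of the patches `y⁻¹(B(c,r))` with the rigidity estimate (61) alone satisfies
`HasReferences` (`0 < α ≤ 1/200`, (13)). [cite: Theil2006, Appendix Proposition 4.8 (60)–(62) (preprint p. 21)] -/
theorem HasReferences.of_exists_rigid {K : ℝ} (hα : 0 < α) (hα' : α ≤ 1 / 200)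
    (hsep : ∀ i j : Fin N, i ≠ j → 1 - α < dist (y i) (y j))
    (h : ∀ (c : Plane) (r R : ℝ), 2 ≤ r → 4 * r + 2 ≤ R → (∀ b ∈ defects α y, R ≤ dist (y b) c) →
      ∃ Φ : Fin N → ℤ × ℤ, IsDiscreteImbeddingOn α y (y ⁻¹' ball c r) Φ ∧
        (∀ x x' : Fin N, y x ∈ ball c r → y x' ∈ ball c r → x ≠ x' →
          |dist (triPoint (Φ x)) (triPoint (Φ x')) / dist (y x) (y x') - 1| ≤ K * α)) :
    HasReferences α y K := by
  refine HasReferences.of_exists hα hα' hsep fun c r R hr hR hdef => ?_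
  obtain ⟨Φ, hΦ, h61⟩ := h c r R hr hR hdef
  refine ⟨Φ, hΦ, h61, fun x ρ hρ hsub g hg => ?_⟩
  have hdef' : ∀ b ∈ defectSet α y, r ≤ dist (y b) c := fun b hb => by
    have := hdef b (mem_defects_iff_mem_defectSet.2 hb); linarith
  exact hΦ.exists_eq_of_ball_subset hα.le (by linarith) hdef' x ρ hρ hsub g hg

/-- A long side parameter exceeds `1` (`Λ ∖ {1} ⊂ [√3, ∞)`). [cite: Theil2006, §2.3 (21) (preprint p. 8)] -/
theorem one_lt_of_mem_distSet_diff {lam : ℝ} (h : lam ∈ distSet \ {1}) : 1 < lam := by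
  have h3 := sqrt_three_le_of_mem_distSet h.1 fun h1 => h.2 h1
  have : (1 : ℝ) < √3 := by
    rw [show (1 : ℝ) = √1 by simp]
    exact Real.sqrt_lt_sqrt (by norm_num) (by norm_num)
  linarith

/-- A centred long simplex keeps the defects `20λ` away from its barycentre (Definition 2.6).
[cite: Theil2006, §2.3 Definition 2.6 (preprint p. 8)] -/
theorem IsCentredSimplex.defects_far {lam : ℝ} {T : Finset (Fin N)}
    (hT : IsCentredSimplex α y lam T) (hlam : 1 < lam) :
    ∀ b ∈ defects α y, 20 * lam < dist (y b) (simplexCentre y T) := by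
  intro b hb
  rcases hT.1.2 with h1 | ⟨-, hfar, -⟩
  · exact absurd h1.1 (ne_of_gt hlam)
  · exact hfar b (mem_defects_iff_mem_defectSet.1 hb)

/-- A centred long simplex has its vertices within `λ` of the barycentre.
[cite: Theil2006, §2.3 Definition 2.6 with Appendix p. 24 ("|⅓Σ y(x) − y(x₁)| ≤ λ")] -/
theorem IsCentredSimplex.dist_centre_le {lam : ℝ} {T : Finset (Fin N)}
    (hT : IsCentredSimplex α y lam T) (hlam : 1 < lam) {x : Fin N} (hx : x ∈ T) :
    dist (y x) (simplexCentre y T) ≤ lam :=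
  hT.2 hlam x hx

/-- **The side parameter of a centred simplex through `{x₁,x₂}` is read off any reference
configuration around the midpoint** — `side_eq_dist_reference` (row 1g) with the radius of the
ball as a parameter: if `T ∈ 𝒯_λ(y)` is centred, contains `x₁ ≠ x₂` (`d = |y(x₁) − y(x₂)|`), and
`Φ` satisfies (60) on `y⁻¹(B(m, ρ))`, `m` the midpoint, `d/2 < ρ ≤ 2λ` (so that `B(m,ρ) ⊂ B̄(z,3λ)`
lies inside the patch `ω_T` of Definition 2.6), then `|Φ(x₁) − Φ(x₂)| = λ` (p. 23, "`λ₁ = λ₂`").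
[cite: Theil2006, Appendix proof of Proposition 2.8 (1) with Proposition 4.8 (60) (preprint pp. 21, 23)] -/
theorem side_eq_dist_reference_of_radius {lam ρ : ℝ} (hα1 : α < 1)
    (hsep : ∀ i j : Fin N, i ≠ j → 1 - α < dist (y i) (y j)) {x₁ x₂ : Fin N} (hx : x₁ ≠ x₂)
    {T : Finset (Fin N)} (hT : IsCentredSimplex α y lam T) (hlam : 1 < lam) (hx₁ : x₁ ∈ T)
    (hx₂ : x₂ ∈ T) (hρ : dist (y x₁) (y x₂) / 2 < ρ) (hρ' : ρ ≤ 2 * lam) {Φ : Fin N → ℤ × ℤ}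
    (h60 : ∀ Φ' : Fin N → ℤ × ℤ,
      IsDiscreteImbeddingOn α y (y ⁻¹' ball ((2 : ℝ)⁻¹ • (y x₁ + y x₂)) ρ) Φ' →
      ∃ Rot : Plane ≃ₗᵢ[ℝ] Plane, ∀ a b : Fin N,
        y a ∈ ball ((2 : ℝ)⁻¹ • (y x₁ + y x₂)) ρ → y b ∈ ball ((2 : ℝ)⁻¹ • (y x₁ + y x₂)) ρ →
        triPoint (Φ' a) - triPoint (Φ' b) = Rot (triPoint (Φ a) - triPoint (Φ b))) :
    dist (triPoint (Φ x₁)) (triPoint (Φ x₂)) = lam := by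
  set m : Plane := (2 : ℝ)⁻¹ • (y x₁ + y x₂) with hm
  set d := dist (y x₁) (y x₂) with hd
  set ω : Set (Fin N) := y ⁻¹' ball m ρ with hω
  have hyinj : Function.Injective y := by
    intro i j hij
    by_contra hne
    have := hsep i j hne
    rw [hij, dist_self] at this
    linarith
  obtain ⟨hT26, hcen⟩ := hT
  have hcen' := hcen hlam
  set z := simplexCentre y T with hz
  have hm1 : dist (y x₁) m = d / 2 := by
    have e : y x₁ - m = (2 : ℝ)⁻¹ • (y x₁ - y x₂) := by rw [hm]; module
    rw [dist_eq_norm, e, norm_smul, Real.norm_eq_abs, abs_of_pos (by norm_num), ← dist_eq_norm, hd]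
    ring
  have hm2 : dist (y x₂) m = d / 2 := by
    have e : y x₂ - m = (2 : ℝ)⁻¹ • (y x₂ - y x₁) := by rw [hm]; module
    rw [dist_eq_norm, e, norm_smul, Real.norm_eq_abs, abs_of_pos (by norm_num), ← dist_eq_norm,
      dist_comm, hd]
    ring
  have hzm : dist z m ≤ lam := by
    have e : z - m = (2 : ℝ)⁻¹ • ((z - y x₁) + (z - y x₂)) := by rw [hm]; module
    rw [dist_eq_norm, e, norm_smul, Real.norm_eq_abs, abs_of_pos (by norm_num)]
    have h := norm_add_le (z - y x₁) (z - y x₂)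
    rw [← dist_eq_norm, ← dist_eq_norm, dist_comm z (y x₁), dist_comm z (y x₂)] at h
    have h1 := hcen' x₁ hx₁
    have h2 := hcen' x₂ hx₂
    linarith
  have hx₁ω : y x₁ ∈ ball m ρ := by rw [mem_ball, hm1]; linarith
  have hx₂ω : y x₂ ∈ ball m ρ := by rw [mem_ball, hm2]; linarith
  rcases hT26.2 with h1 | ⟨-, -, ωT, ΦT, -, hTωT, hΦT, h23, -, h24⟩
  · exact absurd h1.1 (ne_of_gt hlam)
  have hωT : ω ⊆ ωT := by
    intro q hq
    have hq' : y q ∈ closedBall z (3 * lam) ∩ Set.range y := by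
      refine ⟨?_, Set.mem_range_self q⟩
      rw [mem_closedBall]
      have h1 := mem_ball.1 hq
      have := dist_triangle (y q) m z
      rw [dist_comm m z] at this
      linarith
    obtain ⟨q', hq'ω, hyq⟩ := h24 hq'
    rwa [← hyinj hyq]
  obtain ⟨Rot, hRot⟩ := h60 ΦT (hΦT.mono hωT)
  have h := hRot x₁ x₂ hx₁ω hx₂ω
  have h23' := h23 x₁ hx₁ x₂ hx₂ hx
  rw [dist_eq_norm] at h23' ⊢
  rw [h, LinearIsometryEquiv.norm_map] at h23'
  exact h23'

section Consequences

variable {K : ℝ}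

/-! ### Lemma 2.7 (25) -/

/-- **Theil 2006, Lemma 2.7 (25) from Proposition 4.8 (ball form)**, for every centred simplex
`T ∈ 𝒯_λ(y)`, `λ ∈ Λ`, with constant `2K + 1` (`2K` from (60)+(61) on `Ω′ = B(z, λ+1)` for
`λ > 1`, `lemma27_of_reference`; at `λ = 1` the pairs are short bonds, `| |y(x)−y(x′)| − 1| ≤ α`).
[cite: Theil2006, §2.3 Lemma 2.7 (25) with Appendix proof (p. 23) and Proposition 4.8 (60), (61) (preprint pp. 8, 21, 23)] -/
theorem HasReferences.lemma27 (hα : 0 < α) (hα1 : α < 1) (hK : 0 ≤ K) (hKα : K * α ≤ 1 / 2)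
    (hsep : ∀ i j : Fin N, i ≠ j → 1 - α < dist (y i) (y j)) (href : HasReferences α y K) :
    ∀ lam ∈ distSet, ∀ T : Finset (Fin N), IsCentredSimplex α y lam T →
      ∀ x ∈ T, ∀ x' ∈ T, x ≠ x' → |dist (y x) (y x') / lam - 1| ≤ (2 * K + 1) * α := by
  intro lam _ T hT x hx x' hx' hxx'
  by_cases h1 : lam = 1
  · subst h1
    have hs := (isEquilateralSimplex_one_iff.1 (isCentredSimplex_one_iff.1 hT)).2 x hx x' hx' hxx'
    have hs' : |dist (y x) (y x') - 1| ≤ α := hs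
    rw [div_one]
    calc |dist (y x) (y x') - 1| ≤ α := hs'
      _ ≤ (2 * K + 1) * α := by nlinarith
  · have hlt : 1 < lam := lt_of_le_of_ne hT.1.one_le (Ne.symm h1)
    have hfar := hT.defects_far hlt
    obtain ⟨Φ, hΦ⟩ := href (simplexCentre y T) (lam + 1) (4 * (lam + 1) + 2) (by linarith) le_rfl
      (fun b hb => by have := hfar b hb; linarith)
    have h := lemma27_of_reference hα hα1 hKα hsep hT hlt ⟨Φ, hΦ.imbedding, hΦ.unique, hΦ.rigidity⟩
      x hx x' hx' hxx'
    calc |dist (y x) (y x') / lam - 1| ≤ 2 * (K * α) := h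
      _ ≤ (2 * K + 1) * α := by nlinarith

/-! ### Proposition 2.8 (1): uniqueness of the side parameter -/

/-- **Theil 2006, Proposition 2.8 (1), uniqueness of `λ(T)`, from Proposition 4.8 (ball form)**:
a centred simplex lies in at most one `𝒯_λ(y)`, `λ ∈ Λ ∖ {1}` ((60) on
`Ω′ = B(z, min(λ,λ′)+1)`, `sideParameter_unique_of_reference`).
[cite: Theil2006, §2.3 Proposition 2.8 (1) with Appendix proof (p. 23) and Proposition 4.8 (60) (preprint pp. 8, 21, 23)] -/
theorem HasReferences.sideParameter_unique (hα : 0 < α) (hα1 : α < 1)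
    (hsep : ∀ i j : Fin N, i ≠ j → 1 - α < dist (y i) (y j)) (href : HasReferences α y K) :
    ∀ (T : Finset (Fin N)) (lam lam' : ℝ), lam ∈ distSet \ {1} → lam' ∈ distSet \ {1} →
      IsCentredSimplex α y lam T → IsCentredSimplex α y lam' T → lam = lam' := by
  intro T lam lam' hl hl' hT hT'
  have hlt := one_lt_of_mem_distSet_diff hl
  have hlt' := one_lt_of_mem_distSet_diff hl'
  have hfar := hT.defects_far hlt
  have hfar' := hT'.defects_far hlt'
  have hμ : min lam lam' ≤ lam := min_le_left _ _
  have hμ0 : 1 < min lam lam' := lt_min hlt hlt'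
  obtain ⟨Φ, hΦ⟩ := href (simplexCentre y T) (min lam lam' + 1) (4 * (min lam lam' + 1) + 2)
    (by linarith) le_rfl (fun b hb => by have := hfar b hb; linarith)
  exact sideParameter_unique_of_reference hα hα1 hsep hT hT' hlt hlt' ⟨Φ, hΦ.imbedding, hΦ.unique⟩

/-! ### Proposition 2.8 (1): at most two long simplices through a pair -/

/-- **Theil 2006, Proposition 2.8 (1), `#𝒯(x₁,x₂) ≤ 2`, from Proposition 4.8 (ball form)** for the
centred long simplices through a long pair `{x₁,x₂}` (`|y(x₁)−y(x₂)| = d`): a reference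
configuration on `Ω′ = B(m, ρ)`, `ρ = max(d/2+1, 2)` (`m` the midpoint, `Ω = B(m, 4ρ+2)`,
defect-free because a long simplex through the pair keeps the defects `19λ₀` away from `m`) gives
every such simplex the side `λ₀ = |Φ(x₁) − Φ(x₂)|` (`side_eq_dist_reference_of_radius`, the
printed "`λ₁ = λ₂`"), and at the fixed side
`λ₀` at most two exist ((60) on `Ω′ = B(m, 3λ₀/2+1)` and "(68) has at most two solutions",
`card_through_pair_le_two_of_reference`).
[cite: Theil2006, §2.3 Proposition 2.8 (1) with Appendix proof (68) (p. 23) and Proposition 4.8 (60) (preprint pp. 8, 21, 23)] -/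
theorem HasReferences.card_longSimplices_through_le_two (hα : 0 < α) (hα1 : α < 1)
    (hsep : ∀ i j : Fin N, i ≠ j → 1 - α < dist (y i) (y j)) (href : HasReferences α y K) :
    ∀ p ∈ (Finset.univ : Finset (Fin N × Fin N)).filter (fun p => p.1 < p.2) \ shortRangePairs α y,
      ((longSimplices α y).filter fun T => p.1 ∈ T ∧ p.2 ∈ T).card ≤ 2 := by
  classical
  rintro ⟨x₁, x₂⟩ hp
  obtain ⟨hp1, -⟩ := Finset.mem_sdiff.1 hp
  have hlt12 : x₁ < x₂ := (Finset.mem_filter.1 hp1).2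
  have hx : x₁ ≠ x₂ := ne_of_lt hlt12
  set F := (longSimplices α y).filter fun T => x₁ ∈ T ∧ x₂ ∈ T with hF
  show F.card ≤ 2
  by_cases hFe : F = ∅
  · rw [hFe]; simp
  obtain ⟨T₀, hT₀⟩ := Finset.nonempty_iff_ne_empty.2 hFe
  obtain ⟨hT₀l, hx₁T₀, hx₂T₀⟩ := Finset.mem_filter.1 hT₀
  obtain ⟨lam₀, hl₀, hT₀c⟩ := mem_longSimplices.1 hT₀l
  have hlt₀ := one_lt_of_mem_distSet_diff hl₀
  have hfar₀ := hT₀c.defects_far hlt₀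
  set m : Plane := (2 : ℝ)⁻¹ • (y x₁ + y x₂) with hm
  set d : ℝ := dist (y x₁) (y x₂) with hd
  have hd0 : 0 ≤ d := dist_nonneg
  -- the midpoint is within `λ₀` of the barycentre of `T₀`, the pair within `2λ₀` of each other
  have h1 := hT₀c.dist_centre_le hlt₀ hx₁T₀
  have h2 := hT₀c.dist_centre_le hlt₀ hx₂T₀
  have hzm : dist (simplexCentre y T₀) m ≤ lam₀ := by
    have e : simplexCentre y T₀ - m =
        (2 : ℝ)⁻¹ • ((simplexCentre y T₀ - y x₁) + (simplexCentre y T₀ - y x₂)) := by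
      rw [hm]; module
    rw [dist_eq_norm, e, norm_smul, Real.norm_eq_abs, abs_of_pos (by norm_num)]
    have h := norm_add_le (simplexCentre y T₀ - y x₁) (simplexCentre y T₀ - y x₂)
    rw [← dist_eq_norm, ← dist_eq_norm, dist_comm (simplexCentre y T₀) (y x₁),
      dist_comm (simplexCentre y T₀) (y x₂)] at h
    linarith
  have hd2 : d ≤ 2 * lam₀ := by
    have := dist_triangle (y x₁) (simplexCentre y T₀) (y x₂)
    rw [dist_comm (simplexCentre y T₀) (y x₂)] at this
    linarith
  have hdefm : ∀ b ∈ defects α y, 19 * lam₀ < dist (y b) m := by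
    intro b hb
    have h := hfar₀ b hb
    have := dist_triangle (y b) m (simplexCentre y T₀)
    rw [dist_comm m] at this
    linarith
  -- the pair lies within `2λ` of each other for every centred long simplex through it
  have hd2T : ∀ {lam : ℝ} {T : Finset (Fin N)}, IsCentredSimplex α y lam T → 1 < lam →
      x₁ ∈ T → x₂ ∈ T → d ≤ 2 * lam := by
    intro lam T hTc hlt hx₁T hx₂T
    have h1 := hTc.dist_centre_le hlt hx₁T
    have h2 := hTc.dist_centre_le hlt hx₂T
    have := dist_triangle (y x₁) (simplexCentre y T) (y x₂)
    rw [dist_comm (simplexCentre y T) (y x₂)] at this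
    linarith
  -- first reference configuration: around the midpoint, radius max(d/2 + 1, 2)
  set ρ : ℝ := max (d / 2 + 1) 2 with hρ
  have hρ2 : 2 ≤ ρ := le_max_right _ _
  have hρd : d / 2 < ρ := by
    have := le_max_left (d / 2 + 1) 2
    linarith
  have hρl : ρ ≤ lam₀ + 1 := max_le (by linarith) (by linarith)
  obtain ⟨Φ, hΦ⟩ := href m ρ (4 * ρ + 2) hρ2 le_rfl
    (fun b hb => by have := hdefm b hb; nlinarith)
  set L : ℝ := dist (triPoint (Φ x₁)) (triPoint (Φ x₂)) with hL
  -- every simplex of F has side L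
  have hside : ∀ T ∈ F, IsCentredSimplex α y L T := by
    intro T hT
    obtain ⟨hTl, hx₁T, hx₂T⟩ := Finset.mem_filter.1 hT
    obtain ⟨lam, hl, hTc⟩ := mem_longSimplices.1 hTl
    have hlt := one_lt_of_mem_distSet_diff hl
    have hρlam : ρ ≤ 2 * lam :=
      max_le (by linarith [hd2T hTc hlt hx₁T hx₂T]) (by linarith)
    have e := side_eq_dist_reference_of_radius hα1 hsep hx hTc hlt hx₁T hx₂T hρd hρlam hΦ.unique
    rw [← hL] at e
    rw [e]; exact hTc
  have hL₀ : L = lam₀ := by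
    have hρlam : ρ ≤ 2 * lam₀ := max_le (by linarith) (by linarith)
    have e := side_eq_dist_reference_of_radius hα1 hsep hx hT₀c hlt₀ hx₁T₀ hx₂T₀ hρd hρlam
      hΦ.unique
    rw [← hL] at e
    exact e
  have hLt : 1 < L := by rw [hL₀]; exact hlt₀
  have hsub : F ⊆ (simplicesAt α y L).filter fun T => x₁ ∈ T ∧ x₂ ∈ T := by
    intro T hT
    obtain ⟨-, hx₁T, hx₂T⟩ := Finset.mem_filter.1 hT
    exact Finset.mem_filter.2 ⟨mem_simplicesAt.2 (hside T hT), hx₁T, hx₂T⟩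
  -- second reference configuration: around the midpoint, radius 3L/2 + 1
  obtain ⟨Φ', hΦ'⟩ := href m (3 / 2 * L + 1) (6 * L + 6) (by linarith) (by linarith)
    (fun b hb => by have := hdefm b hb; rw [hL₀]; linarith)
  exact (Finset.card_le_card hsub).trans
    (card_through_pair_le_two_of_reference hα hα1 hsep hx hLt ⟨Φ', hΦ'.imbedding, hΦ'.unique⟩)

/-! ### Proposition 2.8 (3): fewer than two long simplices only near a defect -/

/-- **Theil 2006, Proposition 2.8 (3) from Proposition 4.8 (ball form)** (contrapositive of
Proposition 2.8 (2), p. 24): if at most one centred long simplex contains the long pair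
`{x₁,x₂}` (`|y(x₁)−y(x₂)| = d`), then a defect lies within `28d` of the midpoint; for otherwise
`Ω = B(y(x₁), 20d+2) ⊂ B(y(x₁), 27.5d)` is defect-free and the reference configuration on
`Ω′ = B(y(x₁), 5d)` with (61), (62) produces two (`two_le_card_through_pair_of_reference`).
`Kα ≤ 1/10`.
[cite: Theil2006, §2.3 Proposition 2.8 (2), (3) with Appendix proof (p. 24), Proposition 4.8 (61), (62) (preprint pp. 8–9, 21, 24)] -/
theorem HasReferences.exists_defect_near_pair (hα : 0 < α) (hα1 : α < 1) (hKα : K * α ≤ 1 / 10)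
    (hsep : ∀ i j : Fin N, i ≠ j → 1 - α < dist (y i) (y j)) (href : HasReferences α y K) :
    ∀ p ∈ (Finset.univ : Finset (Fin N × Fin N)).filter (fun p => p.1 < p.2) \ shortRangePairs α y,
      ((longSimplices α y).filter fun T => p.1 ∈ T ∧ p.2 ∈ T).card ≤ 1 →
        ∃ b ∈ defects α y,
          dist ((2 : ℝ)⁻¹ • (y p.1 + y p.2)) (y b) < 28 * dist (y p.1) (y p.2) := by
  classical
  rintro ⟨x₁, x₂⟩ hp hcard
  obtain ⟨hp1, hp2⟩ := Finset.mem_sdiff.1 hp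
  have hlt12 : x₁ < x₂ := (Finset.mem_filter.1 hp1).2
  have hx : x₁ ≠ x₂ := ne_of_lt hlt12
  have hlong : ¬ IsShortRange α y x₁ x₂ := fun h =>
    hp2 (mem_shortRangePairs_iff.2 ⟨hlt12, h⟩)
  by_contra hno
  push Not at hno
  set m : Plane := (2 : ℝ)⁻¹ • (y x₁ + y x₂) with hm
  set d : ℝ := dist (y x₁) (y x₂) with hd
  -- d > 1
  have hd1 : 1 < d := by
    have h1 := hsep x₁ x₂ hx
    by_contra hle
    exact hlong (show |dist (y x₁) (y x₂) - 1| ≤ α from abs_le.2 ⟨by linarith, by linarith⟩)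
  have hm1 : dist (y x₁) m = d / 2 := by
    have e : y x₁ - m = (2 : ℝ)⁻¹ • (y x₁ - y x₂) := by rw [hm]; module
    rw [dist_eq_norm, e, norm_smul, Real.norm_eq_abs, abs_of_pos (by norm_num), ← dist_eq_norm, hd]
    ring
  -- the defects are `27.5 d` away from `y x₁`
  have hfar : ∀ b ∈ defects α y, 55 / 2 * d ≤ dist (y b) (y x₁) := by
    intro b hb
    have h := hno b hb
    have h3 := dist_triangle m (y x₁) (y b)
    rw [dist_comm m (y x₁), hm1] at h3
    rw [dist_comm (y b) (y x₁)]
    linarith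
  obtain ⟨Φ, hΦ⟩ := href (y x₁) (5 * d) (20 * d + 2) (by linarith) (by linarith)
    (fun b hb => by have := hfar b hb; linarith)
  have h62 : ∀ g : ℤ × ℤ, dist (triPoint g) (triPoint (Φ x₁)) < 2 * dist (y x₁) (y x₂) →
      ∃ v : Fin N, y v ∈ ball (y x₁) (5 * d) ∧ Φ v = g :=
    fun g hg => hΦ.surjective x₁ (4 * d) (by linarith) (ball_subset_ball (by linarith)) g
      (by linarith)
  have hfar' : ∀ b ∈ defectSet α y, 24 * dist (y x₁) (y x₂) ≤ dist (y b) (y x₁) := by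
    intro b hb
    have := hfar b (mem_defects_iff_mem_defectSet.2 hb)
    rw [← hd]; linarith
  obtain ⟨hLmem, h2⟩ := two_le_card_through_pair_of_reference hα hα1 hKα hsep hx hlong
    (by linarith : 5 * dist (y x₁) (y x₂) ≤ 5 * d) hΦ.imbedding hΦ.rigidity h62 hfar'
  set L := dist (triPoint (Φ x₁)) (triPoint (Φ x₂)) with hL
  have hsub : ((simplicesAt α y L).filter fun T => x₁ ∈ T ∧ x₂ ∈ T) ⊆
      (longSimplices α y).filter fun T => x₁ ∈ T ∧ x₂ ∈ T := by
    intro T hT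
    obtain ⟨hTs, hx₁T, hx₂T⟩ := Finset.mem_filter.1 hT
    exact Finset.mem_filter.2 ⟨mem_longSimplices.2 ⟨L, hLmem, mem_simplicesAt.1 hTs⟩, hx₁T, hx₂T⟩
  have := (h2.trans (Finset.card_le_card hsub)).trans hcard
  omega

/-! ### (70) and the near-defect alternative -/

/-- **Theil 2006, (70) `s(x,λ) ≤ m(λ) s(x,1)` from Proposition 4.8 (ball form)** (`λ ∈ Λ ∖ {1}`,
`0 < α ≤ 1/200`): if `s(x,λ) ≠ 0` a centred simplex with corner `x` keeps the defects `19λ` away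
from `y(x)`, and the reference configuration on `Ω′ = B(y(x), ρ′)`, where
`y⁻¹(B̄(y(x),2λ)) = y⁻¹(B(y(x),ρ′))` with `2λ < ρ′ ≤ 2λ+1` (`preimage_closedBall_eq_ball`), feeds
`h70_of_reference`.
[cite: Theil2006, Appendix proof of Proposition 2.9 (70) with Proposition 4.8 (60) (preprint pp. 21, 24)] -/
theorem HasReferences.h70 (hα : 0 < α) (hα' : α ≤ 1 / 200)
    (hsep : ∀ i j : Fin N, i ≠ j → 1 - α < dist (y i) (y j)) (href : HasReferences α y K) :
    ∀ lam : ↥(distSet \ {1}), ∀ x : Fin N,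
      cornerCount α y lam x ≤ m (lam : ℝ) * cornerCount α y 1 x := by
  classical
  intro lam x
  have hlt : 1 < (lam : ℝ) := one_lt_of_mem_distSet_diff lam.2
  by_cases h0 : cornerCount α y lam x = 0
  · rw [h0]; exact Nat.zero_le _
  obtain ⟨T, hT⟩ := Finset.card_pos.1 (Nat.pos_of_ne_zero h0)
  obtain ⟨hTs, hxT⟩ := Finset.mem_filter.1 hT
  have hTc := mem_simplicesAt.1 hTs
  have hcx := hTc.dist_centre_le hlt hxT
  have hfar : ∀ b ∈ defects α y, 19 * (lam : ℝ) < dist (y b) (y x) := by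
    intro b hb
    have h := hTc.defects_far hlt b hb
    have := dist_triangle (y b) (y x) (simplexCentre y T)
    linarith
  obtain ⟨ρ', hρ', hρ'le, hset⟩ := preimage_closedBall_eq_ball y (y x) (2 * lam)
  obtain ⟨Φ, hΦ⟩ := href (y x) ρ' (4 * ρ' + 2) (by linarith) le_rfl
    (fun b hb => by have := hfar b hb; linarith)
  refine h70_of_reference hα hα' hsep x hlt ⟨Φ, ?_, fun Φ' hΦ' => ?_⟩
  · rw [hset]; exact hΦ.imbedding
  · rw [hset] at hΦ'
    obtain ⟨Rot, hRot⟩ := hΦ.unique Φ' hΦ'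
    refine ⟨Rot, fun a b ha hb => hRot a b ?_ ?_⟩
    · have : a ∈ y ⁻¹' closedBall (y x) (2 * lam) := ha
      rw [hset] at this; exact this
    · have : b ∈ y ⁻¹' closedBall (y x) (2 * lam) := hb
      rw [hset] at this; exact this

/-- **Theil 2006, the near-defect alternative of p. 24 from Proposition 4.8 (ball form)**: "for
each `x ∈ X` with the property that `s(x,λ) < 6m(λ)` there exists `x_b ∈ ∂X` such that
`y(x_b) ∈ B(y(x), 28λ)`" — for otherwise `Ω = B(y(x), 20λ+2) ⊂ B(y(x), 28λ)` is defect-free and the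
reference configuration on `Ω′ = B(y(x), 5λ)` with (61), (62) yields `6m(λ)` centred simplices with
corner `x` (`six_m_le_cornerCount_of_reference`). `Kα ≤ 1/3`.
[cite: Theil2006, Appendix proof of Proposition 2.9 ((70), "other direction") with Proposition 2.8 (2), Proposition 4.8 (61), (62) (preprint pp. 21, 24)] -/
theorem HasReferences.exists_defect_near_corner (hα : 0 < α) (hα1 : α < 1) (hKα : K * α ≤ 1 / 3)
    (hsep : ∀ i j : Fin N, i ≠ j → 1 - α < dist (y i) (y j)) (href : HasReferences α y K) :
    ∀ lam : ↥(distSet \ {1}), ∀ x : Fin N, cornerCount α y lam x < 6 * m (lam : ℝ) →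
      ∃ b ∈ defects α y, dist (y x) (y b) ≤ 28 * lam := by
  intro lam x hlt6
  have hlt : 1 < (lam : ℝ) := one_lt_of_mem_distSet_diff lam.2
  by_contra hno
  push Not at hno
  obtain ⟨Φ, hΦ⟩ := href (y x) (5 * lam) (20 * lam + 2) (by linarith) (by linarith)
    (fun b hb => by have := hno b hb; rw [dist_comm] at this; linarith)
  have h62 : ∀ g : ℤ × ℤ, dist (triPoint g) (triPoint (Φ x)) < 3 / 2 * lam →
      ∃ v : Fin N, y v ∈ ball (y x) (5 * lam) ∧ Φ v = g :=
    fun g hg => hΦ.surjective x (3 * lam) (by linarith) (ball_subset_ball (by linarith)) g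
      (by linarith)
  have hfar : ∀ b ∈ defectSet α y, 21 * (lam : ℝ) < dist (y b) (y x) := by
    intro b hb
    have := hno b (mem_defects_iff_mem_defectSet.2 hb)
    rw [dist_comm] at this; linarith
  have h6 := six_m_le_cornerCount_of_reference hα hα1 hKα hsep x hlt (by linarith) hΦ.imbedding
    hΦ.rigidity h62 hfar
  omega

/-! ### (28): the multiplicity of the patches `ω_T` -/

/-- **Theil 2006, (28) `#{T ∈ 𝒯_λ(y) | ω_T ∋ x} ≤ Cλ²m(λ)` from Proposition 4.8 (ball form)**
("Proof of (28). This follows directly from (70) and (71).", Appendix p. 25), for ANY choice of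
patches `ω_T` with `y(ω_T) ⊂ B̄(z_T, 5λ)` (the upper inclusion of (24), Definition 2.6), centred
simplices, `λ ∈ Λ ∖ {1}`, `0 < α ≤ 1/200`, (13): a simplex whose patch contains `x` has a corner
`x′` with `|y(x′) − y(x)| ≤ 6λ`; there are at most `4(12λ+1)²` such `x′` ((71)-type disc count,
`card_filter_dist_le_le`) and each is a corner of at most `s(x′,λ) ≤ 6m(λ)` simplices ((70),
`HasReferences.h70`, with `s(x′,1) ≤ 6`); `4(12λ+1)² · 6m(λ) ≤ 4056 λ² m(λ)`.
[cite: Theil2006, §2.3 Proposition 2.9 (28) with Appendix proof (p. 25), (70), (71) (preprint pp. 9, 24–25); constant ours] -/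
theorem HasReferences.card_filter_mem_patch_le (hα : 0 < α) (hα' : α ≤ 1 / 200)
    (hsep : ∀ i j : Fin N, i ≠ j → 1 - α < dist (y i) (y j)) (href : HasReferences α y K)
    (lam : ↥(distSet \ {1})) {ω : Finset (Fin N) → Finset (Fin N)}
    (hω : ∀ T ∈ simplicesAt α y lam, ∀ a ∈ ω T, dist (y a) (simplexCentre y T) ≤ 5 * lam)
    (x : Fin N) :
    (((simplicesAt α y lam).filter fun T => x ∈ ω T).card : ℝ) ≤
      4056 * (lam : ℝ) ^ 2 * m (lam : ℝ) := by
  classical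
  have hlt : 1 < (lam : ℝ) := one_lt_of_mem_distSet_diff lam.2
  set P := Finset.univ.filter fun x' : Fin N => dist (y x') (y x) ≤ 6 * lam with hP
  have hPcard : (P.card : ℝ) ≤ 4 * (2 * (6 * lam) + 1) ^ 2 :=
    card_filter_dist_le_le hα (by linarith) hsep (y x) (by linarith)
  -- a simplex whose patch contains `x` has a corner within `6λ` of `y x`
  have hsub : ((simplicesAt α y lam).filter fun T => x ∈ ω T) ⊆
      P.biUnion fun x' => (simplicesAt α y lam).filter fun T => x' ∈ T := by
    intro T hT
    obtain ⟨hTs, hxT⟩ := Finset.mem_filter.1 hT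
    have hTc := mem_simplicesAt.1 hTs
    obtain ⟨a, haT⟩ : T.Nonempty := by
      rw [← Finset.card_pos, hTc.1.card_eq_three]; norm_num
    have ha : dist (y a) (simplexCentre y T) ≤ lam := hTc.dist_centre_le hlt haT
    have hxz := hω T hTs x hxT
    refine Finset.mem_biUnion.2 ⟨a, Finset.mem_filter.2 ⟨Finset.mem_univ _, ?_⟩,
      Finset.mem_filter.2 ⟨hTs, haT⟩⟩
    have := dist_triangle (y a) (simplexCentre y T) (y x)
    rw [dist_comm (simplexCentre y T) (y x)] at this
    linarith
  have h1 : ((((simplicesAt α y lam).filter fun T => x ∈ ω T).card : ℕ) : ℝ) ≤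
      ∑ x' ∈ P, (cornerCount α y lam x' : ℝ) := by
    have h := (Finset.card_le_card hsub).trans Finset.card_biUnion_le
    unfold cornerCount
    exact_mod_cast h
  have h2 : ∀ x' ∈ P, (cornerCount α y lam x' : ℝ) ≤ 6 * m (lam : ℝ) := by
    intro x' _
    have h70 := href.h70 hα hα' hsep lam x'
    have h6 := cornerCount_one_le_six hα (by linarith) hsep x'
    have h : cornerCount α y lam x' ≤ m (lam : ℝ) * 6 := h70.trans (Nat.mul_le_mul_left _ h6)
    calc (cornerCount α y lam x' : ℝ) ≤ ((m (lam : ℝ) * 6 : ℕ) : ℝ) := by exact_mod_cast h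
      _ = 6 * m (lam : ℝ) := by push_cast; ring
  have hM : (0 : ℝ) ≤ m (lam : ℝ) := Nat.cast_nonneg _
  have hl2 : (2 * (6 * (lam : ℝ)) + 1) ^ 2 ≤ 169 * (lam : ℝ) ^ 2 := by nlinarith
  calc ((((simplicesAt α y lam).filter fun T => x ∈ ω T).card : ℕ) : ℝ)
      ≤ ∑ x' ∈ P, (cornerCount α y lam x' : ℝ) := h1
    _ ≤ ∑ x' ∈ P, (6 * m (lam : ℝ) : ℝ) := Finset.sum_le_sum h2
    _ = P.card * (6 * m (lam : ℝ)) := by rw [Finset.sum_const, nsmul_eq_mul]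
    _ ≤ 4 * (2 * (6 * lam) + 1) ^ 2 * (6 * m (lam : ℝ)) :=
        mul_le_mul_of_nonneg_right hPcard (by positivity)
    _ ≤ 4056 * (lam : ℝ) ^ 2 * m (lam : ℝ) := by
        nlinarith [mul_le_mul_of_nonneg_right hl2 (by positivity : (0 : ℝ) ≤ 24 * m (lam : ℝ))]

/-- **The (34)-inputs from the p. 11 display and Proposition 4.8 (ball form).** If for every
`λ ∈ Λ ∖ {1}` there are patches `ω_T` with `y(ω_T) ⊂ B̄(z_T, 5λ)` on which the printed per-simplex
rigidity estimate "`Σ_{{x,x′}⊂T} (|y(x)−y(x′)| − λ)² ≤ C log(λ) Σ_{{x,x′}∈𝒮, {x,x′}⊂ω_T} (|y(x)−y(x′)| − 1)²`"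
(p. 11, "the L²-rigidity estimate provided by Proposition 4.3 applied to `u(ξ) := y(Φ⁻¹(ξ))`")
holds, then together with (28) (`card_filter_mem_patch_le`, `C₂₈ = 4056`) these patches satisfy
the hypothesis `hrig` of `Theil2006.geometryPackage_of_local` / `h34_of_rigidity_of_multiplicity`.
[cite: Theil2006, §2.4 display before (34) and (28) (preprint pp. 9, 11, 25)] -/
theorem HasReferences.rigidityInputs (hα : 0 < α) (hα' : α ≤ 1 / 200)
    (hsep : ∀ i j : Fin N, i ≠ j → 1 - α < dist (y i) (y j)) (href : HasReferences α y K)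
    {C₅₂ : ℝ}
    (h52 : ∀ lam : ↥(distSet \ {1}), ∃ ω : Finset (Fin N) → Finset (Fin N),
      (∀ T ∈ simplicesAt α y lam, ∀ a ∈ ω T, dist (y a) (simplexCentre y T) ≤ 5 * lam) ∧
      (∀ T ∈ simplicesAt α y lam,
        1 / 2 * ∑ p ∈ T.offDiag, (dist (y p.1) (y p.2) - lam) ^ 2 ≤
          C₅₂ * Real.log (lam : ℝ) *
            ∑ p ∈ (shortRangePairs α y).filter (fun p => p.1 ∈ ω T ∧ p.2 ∈ ω T),
              (dist (y p.1) (y p.2) - 1) ^ 2)) :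
    ∀ lam : ↥(distSet \ {1}), ∃ ω : Finset (Fin N) → Finset (Fin N),
      (∀ T ∈ simplicesAt α y lam,
        1 / 2 * ∑ p ∈ T.offDiag, (dist (y p.1) (y p.2) - lam) ^ 2 ≤
          C₅₂ * Real.log (lam : ℝ) *
            ∑ p ∈ (shortRangePairs α y).filter (fun p => p.1 ∈ ω T ∧ p.2 ∈ ω T),
              (dist (y p.1) (y p.2) - 1) ^ 2) ∧
      (∀ x : Fin N, (((simplicesAt α y lam).filter fun T => x ∈ ω T).card : ℝ) ≤
        4056 * (lam : ℝ) ^ 2 * m (lam : ℝ)) := by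
  intro lam
  obtain ⟨ω, hω, h52'⟩ := h52 lam
  exact ⟨ω, h52', fun x => href.card_filter_mem_patch_le hα hα' hsep lam hω x⟩

/-! ### The six local statements bundled -/

/-- **The Proposition-4.8 part of the local geometry package** (the first six clauses of the
hypothesis `hlocal` of `Theil2006_mainTheorems_of_localGeometry`, `Theil2006FromGeometry.lean`):
Lemma 2.7 (25) with constant `2K+1`, Proposition 2.8 (1) (count and uniqueness), (3), (70) and the
near-defect alternative, for one configuration with (13), from `HasReferences α y K`
(`0 < α ≤ 1/200`, `0 ≤ K`, `Kα ≤ 1/10`).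
[cite: Theil2006, §2.3 Lemma 2.7, Proposition 2.8, Appendix Proposition 4.8 and pp. 23–24 (preprint)] -/
theorem HasReferences.localGeometry (hα : 0 < α) (hα' : α ≤ 1 / 200) (hK : 0 ≤ K)
    (hKα : K * α ≤ 1 / 10) (hsep : ∀ i j : Fin N, i ≠ j → 1 - α < dist (y i) (y j))
    (href : HasReferences α y K) :
    (∀ lam ∈ distSet, ∀ T : Finset (Fin N), IsCentredSimplex α y lam T →
      ∀ x ∈ T, ∀ x' ∈ T, x ≠ x' → |dist (y x) (y x') / lam - 1| ≤ (2 * K + 1) * α) ∧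
    (∀ p ∈ (Finset.univ : Finset (Fin N × Fin N)).filter (fun p => p.1 < p.2) \
        shortRangePairs α y, ((longSimplices α y).filter fun T => p.1 ∈ T ∧ p.2 ∈ T).card ≤ 2) ∧
    (∀ (T : Finset (Fin N)) (lam lam' : ℝ), lam ∈ distSet \ {1} → lam' ∈ distSet \ {1} →
      IsCentredSimplex α y lam T → IsCentredSimplex α y lam' T → lam = lam') ∧
    (∀ p ∈ (Finset.univ : Finset (Fin N × Fin N)).filter (fun p => p.1 < p.2) \
        shortRangePairs α y, ((longSimplices α y).filter fun T => p.1 ∈ T ∧ p.2 ∈ T).card ≤ 1 →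
        ∃ b ∈ defects α y,
          dist ((2 : ℝ)⁻¹ • (y p.1 + y p.2)) (y b) < 28 * dist (y p.1) (y p.2)) ∧
    (∀ lam : ↥(distSet \ {1}), ∀ x : Fin N,
      cornerCount α y lam x ≤ m (lam : ℝ) * cornerCount α y 1 x) ∧
    (∀ lam : ↥(distSet \ {1}), ∀ x : Fin N, cornerCount α y lam x < 6 * m (lam : ℝ) →
      ∃ b ∈ defects α y, dist (y x) (y b) ≤ 28 * lam) := by
  have hα1 : α < 1 := by linarith
  exact ⟨href.lemma27 hα hα1 hK (by linarith) hsep, href.card_longSimplices_through_le_two hα hα1 hsep,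
    href.sideParameter_unique hα hα1 hsep, href.exists_defect_near_pair hα hα1 hKα hsep,
    href.h70 hα hα' hsep, href.exists_defect_near_corner hα hα1 (by linarith) hsep⟩

end Consequences

end Theil2006

end Literature.MathematicalPhysics.StatisticalMechanics

end
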